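import Literature.MathematicalPhysics.QuantumFieldTheory.BalabanImbrieJaffe1984to88.BIJ88Resummation5710

/-!
# `BalabanImbrieJaffe1984to88.BIJ88Resummation5710Restrict` — T. Bałaban, J. Imbrie, A. Jaffe, *Effective action and
cluster properties of the abelian Higgs model*, Commun. Math. Phys. **114** (1988) 257–315 [BalabanImbrieJaffe1988]:
Sect. 5.7, p. 292 [PDF 36] — the ONE printed step between the first low-order display and (5.7.10) that
`BIJ88Resummation5710` (p13 g11, p313665/p314319) leaves as «the choice of the active scale set `S`»:

*"Note that Z^{(j)}_{Λ₁₀^{(j)}}(…) depends only on e_l for l ≥ j. Thus we can write the last expression as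
Σ_{m=j}^{k} Σ_{n=1}^{n̄} (1/n!) Σ_{{j_α}: min_α j_α = m} [Π_α ∂/∂e′_{j_α} log Z^{(j)}_{Λ₁₀^{(j)}}(u_{k+1} exp(ie_jζ Σ_{l=j}^{k} e′_l Ã̃_l))]_{e′=0}. (5.7.10)"*

Here the first display sums the derivatives over ALL scales `j_α = 0, …, k` (and `l = 0, …, k` in the exponent), while (5.7.10)
keeps only `m, l ≥ j`.  The passage is: a generating function that depends on the parameters `e′_l`, `l ∈ S` only has vanishing
mixed partials in every tuple of directions containing a scale outside `S`, so the low-order terms over any scale set `T` equal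
those over `T ∩ S`, and THEN (5.7.10) (`eq5710`) regroups by the minimal scale INSIDE `T ∩ S`.

statement-level skeleton of published theorems with citation tags; proofs where landed; nothing here is a claim about the Yang–Mills mass gap

WHAT IS PROVED (kernel-checked, 0 `sorry`, no `Prop`-valued fact; one definition with body `projOn` + one `Prop`-valued
definition with body `DependsOnlyOn` (a hypothesis SHAPE, never asserted) + theorems; axioms standard):
* `projOn S` — the coordinate projection `e′ ↦ e′·𝟙_S` (switch off the scales outside `S`), a continuous linear map;
  `projOn_single_of_mem` / `projOn_single_of_not_mem`, `projOn_sum_single` (`projOn S 𝟙_T = 𝟙_{T∩S}`).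
* `DependsOnlyOn Φ S` — *"depends only on e_l for l ∈ S"*: `Φ = Φ ∘ projOn S`.
* **`mixedPartial_eq_zero_of_exists_not_mem`** — for `Φ ∈ Cⁿ` depending only on `S`: `[Π_α ∂/∂e′_{j_α} Φ]_{e′=0} = 0` as soon as
  one `j_α ∉ S` (chain rule `ContinuousLinearMap.iteratedFDeriv_comp_right` + multilinearity `map_coord_zero`).
* **`dirPower_eq_dirPower_inter`**, **`lowOrder_eq_lowOrder_inter`** — `[(Σ_{l∈T}∂_l)ⁿΦ](0) = [(Σ_{l∈T∩S}∂_l)ⁿΦ](0)` and hence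
  the low-order terms over `T` are those over `T ∩ S`.
* **`eq5710_of_dependsOnlyOn`** — THE PRINTED PASSAGE END TO END: `lowOrder Φ n̄ T = Σ_{m ∈ T∩S} leadGroup Φ n̄ (T∩S) m`
  (print: `T = {0,…,k}`, `S = {j,…,k}`, so `T ∩ S = {j,…,k}` and the groups are `m = j, …, k`).

HONEST SCOPE.  Finite-dimensional calculus only; `Φ` (print: `e′ ↦ log Z^{(j)}_{Λ₁₀^{(j)}}(u_{k+1} exp(ie_jζ Σ_l e′_l Ã̃_l))`) and its
smoothness `ContDiff ℝ n̄ Φ` are inputs, as in `BIJ88Resummation5710`; WHY `log Z^{(j)}` depends only on the scales `l ≥ j` (the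
fields `Ã̃_l`, `l < j`, do not enter the `j`-th step objects) is the print's observation about its own construction and is the
hypothesis `DependsOnlyOn` here, not derived.  Residual reading (r1) of the owner's v2.66 head of row C2.Eq5.7.10-5.7.12 retired
by this file; nothing else of that row is touched.

CITATION HEADER (lean-in-tree rule).  Part of the lit-balaban TYPED SKELETON (HOME `run/shared/lean/pub/lit-balaban/`): row
**C2.Eq5.7.10-5.7.12** of `HOME/lit-balaban-r16/ROWS-C2-part2.md` (E-row, pp. 291–294; head `proved` v2.66), member *(5.7.10),
the «depends only on e_l for l ≥ j» step*.  Unit `lit-balaban-r16` (C2 §5 fold owner, own lane; literature-prover-lit-balaban-r16-g10-0,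
2026-08-22), referee ref-5.  Built BY NAME on p13 g11's `BIJ88Resummation5710` (`mixedPartial`, `dirPower`, `lowOrder`,
`leadGroup`, `eq5710`); nothing restated.  PDF held: `paper:balaban1988-cmp114-bij-abelian-higgs-effective-action` (journal
page = PDF page + 256); p. 292 [PDF 36] re-rendered and re-read as an image this session (`renders/original-p036-x2.png` of the
seat folder).  NOT summit progress.
-/

noncomputable section

open scoped BigOperators
open Finset

namespace Literature.MathematicalPhysics.QuantumFieldTheory.BalabanImbrieJaffe1984to88.BIJ88Resummation5710Restrict

open Literature.MathematicalPhysics.QuantumFieldTheory.BalabanImbrieJaffe1984to88.BIJ88Resummation5710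

variable {L : Type*} [Fintype L] [DecidableEq L] [LinearOrder L]

/-! ## §1 Switching off the scales outside `S` -/

/-- The coordinate projection `e′ ↦ (e′_l · 1_{l∈S})_l` — the parameters outside `S` switched off — as a linear map.
[cite: BalabanImbrieJaffe1988, (5.7.10) p.292] -/
def projOnLin (S : Finset L) : (L → ℝ) →ₗ[ℝ] (L → ℝ) where
  toFun x := fun l => if l ∈ S then x l else 0
  map_add' x y := by
    funext l
    by_cases h : l ∈ S <;> simp [h]
  map_smul' c x := by
    funext l
    by_cases h : l ∈ S <;> simp [h]

/-- The coordinate projection onto the scales of `S` as a CONTINUOUS linear map (finite dimension).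
[cite: BalabanImbrieJaffe1988, (5.7.10) p.292] -/
def projOn (S : Finset L) : (L → ℝ) →L[ℝ] (L → ℝ) := LinearMap.toContinuousLinearMap (projOnLin S)

omit [LinearOrder L] in
/-- `projOn S x l = x l` for `l ∈ S`, `= 0` otherwise. [cite: BalabanImbrieJaffe1988, (5.7.10) p.292] -/
theorem projOn_apply (S : Finset L) (x : L → ℝ) (l : L) : projOn S x l = if l ∈ S then x l else 0 := rfl

omit [LinearOrder L] in
/-- `projOn S 0 = 0`. [cite: BalabanImbrieJaffe1988, (5.7.10) p.292] -/
theorem projOn_zero (S : Finset L) : projOn S (0 : L → ℝ) = 0 := map_zero _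

omit [LinearOrder L] in
/-- a coordinate direction inside `S` is kept. [cite: BalabanImbrieJaffe1988, (5.7.10) p.292] -/
theorem projOn_single_of_mem {S : Finset L} {l : L} (hl : l ∈ S) :
    projOn S (Pi.single l (1 : ℝ)) = Pi.single l (1 : ℝ) := by
  funext l'
  rw [projOn_apply]
  by_cases h : l' ∈ S
  · simp [h]
  · have hne : l' ≠ l := fun heq => h (heq ▸ hl)
    simp [h, hne]

omit [LinearOrder L] in
/-- a coordinate direction outside `S` is switched off: *"depends only on e_l for l ≥ j"* kills `∂/∂e′_l`, `l < j`.
[cite: BalabanImbrieJaffe1988, (5.7.10) p.292] -/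
theorem projOn_single_of_not_mem {S : Finset L} {l : L} (hl : l ∉ S) :
    projOn S (Pi.single l (1 : ℝ)) = 0 := by
  funext l'
  rw [projOn_apply]
  by_cases h : l' ∈ S
  · have hne : l' ≠ l := fun heq => hl (heq ▸ h)
    simp [h, hne]
  · simp [h]

omit [LinearOrder L] in
/-- `projOn S 𝟙_T = 𝟙_{T ∩ S}`: switching on all scales of `T` and then switching off those outside `S` switches on exactly
`T ∩ S`. [cite: BalabanImbrieJaffe1988, (5.7.10) p.292] -/
theorem projOn_sum_single (S T : Finset L) :
    projOn S (∑ l ∈ T, (Pi.single l (1 : ℝ) : L → ℝ)) = ∑ l ∈ T ∩ S, (Pi.single l (1 : ℝ) : L → ℝ) := by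
  rw [map_sum, ← Finset.sum_filter_add_sum_filter_not T (fun l => l ∈ S)]
  have h1 : ∑ l ∈ T.filter (fun l => l ∈ S), projOn S (Pi.single l (1 : ℝ)) =
      ∑ l ∈ T ∩ S, (Pi.single l (1 : ℝ) : L → ℝ) := by
    rw [Finset.filter_mem_eq_inter]
    exact Finset.sum_congr rfl fun l hl => projOn_single_of_mem (Finset.mem_inter.mp hl).2
  have h2 : ∑ l ∈ T.filter (fun l => ¬ l ∈ S), projOn S (Pi.single l (1 : ℝ)) = 0 :=
    Finset.sum_eq_zero fun l hl => projOn_single_of_not_mem (Finset.mem_filter.mp hl).2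
  rw [h1, h2, add_zero]

/-! ## §2 *"depends only on e_l for l ∈ S"* -/

/-- `Φ` DEPENDS ONLY ON THE PARAMETERS `e′_l`, `l ∈ S` (print: *"Z^{(j)}_{Λ₁₀^{(j)}}(…) depends only on e_l for l ≥ j"*, `S =
{j,…,k}`): `Φ(e′) = Φ(e′·𝟙_S)` for every `e′`.  A hypothesis SHAPE (a `Prop` with a body), never asserted in this file.
[cite: BalabanImbrieJaffe1988, (5.7.10) p.292] -/
def DependsOnlyOn (Φ : (L → ℝ) → ℝ) (S : Finset L) : Prop := ∀ x, Φ x = Φ (projOn S x)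

omit [LinearOrder L] in
/-- unfolding lemma. [cite: BalabanImbrieJaffe1988, (5.7.10) p.292] -/
theorem dependsOnlyOn_iff (Φ : (L → ℝ) → ℝ) (S : Finset L) :
    DependsOnlyOn Φ S ↔ Φ = Φ ∘ projOn S :=
  ⟨fun h => funext fun x => h x, fun h x => congrFun h x⟩

omit [LinearOrder L] in
/-- a function of the switched-off parameters only, `Ψ ∘ projOn S`, depends only on `S` (non-vacuity of the hypothesis shape;
`projOn S` is idempotent). [cite: BalabanImbrieJaffe1988, (5.7.10) p.292] -/
theorem dependsOnlyOn_comp_projOn (Ψ : (L → ℝ) → ℝ) (S : Finset L) : DependsOnlyOn (Ψ ∘ projOn S) S := by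
  intro x
  simp only [Function.comp_apply]
  congr 1
  funext l
  rw [projOn_apply, projOn_apply, projOn_apply]
  by_cases h : l ∈ S <;> simp [h]

/-! ## §3 The printed passage: mixed partials with an inactive scale vanish; low-order terms over `T` = over `T ∩ S` -/

omit [LinearOrder L] in
/-- chain rule for `Φ = Φ ∘ projOn S`: the `n`-th derivative at `0` sees only the projected directions.
[cite: BalabanImbrieJaffe1988, (5.7.10) p.292] -/
theorem iteratedFDeriv_apply_eq_projOn {Φ : (L → ℝ) → ℝ} {S : Finset L} (hΦ : DependsOnlyOn Φ S) {n : ℕ}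
    (hcd : ContDiff ℝ n Φ) (v : Fin n → (L → ℝ)) :
    iteratedFDeriv ℝ n Φ 0 v = iteratedFDeriv ℝ n Φ 0 (fun α => projOn S (v α)) := by
  have hcomp : Φ = Φ ∘ projOn S := (dependsOnlyOn_iff Φ S).mp hΦ
  conv_lhs => rw [hcomp]
  rw [ContinuousLinearMap.iteratedFDeriv_comp_right (projOn S) hcd 0 le_rfl, projOn_zero,
    ContinuousMultilinearMap.compContinuousLinearMap_apply]

omit [LinearOrder L] in
/-- **«depends only on e_l for l ≥ j» ⇒ the tuples with some j_α < j drop out**: for `Φ ∈ Cⁿ` depending only on `S`,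
`[Π_α ∂/∂e′_{j_α} Φ]_{e′=0} = 0` whenever some `j_α ∉ S`. [cite: BalabanImbrieJaffe1988, (5.7.10) p.292] -/
theorem mixedPartial_eq_zero_of_exists_not_mem {Φ : (L → ℝ) → ℝ} {S : Finset L} (hΦ : DependsOnlyOn Φ S) {n : ℕ}
    (hcd : ContDiff ℝ n Φ) {J : Fin n → L} (hJ : ∃ α, J α ∉ S) : mixedPartial Φ n J = 0 := by
  obtain ⟨α, hα⟩ := hJ
  unfold mixedPartial
  rw [iteratedFDeriv_apply_eq_projOn hΦ hcd]
  exact ContinuousMultilinearMap.map_coord_zero _ α (by simp only [projOn_single_of_not_mem hα])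

omit [LinearOrder L] in
/-- **`[(Σ_{l∈T} ∂_l)ⁿ Φ](0) = [(Σ_{l∈T∩S} ∂_l)ⁿ Φ](0)`** for `Φ ∈ Cⁿ` depending only on `S`.
[cite: BalabanImbrieJaffe1988, (5.7.10) p.292] -/
theorem dirPower_eq_dirPower_inter {Φ : (L → ℝ) → ℝ} {S : Finset L} (hΦ : DependsOnlyOn Φ S) {n : ℕ}
    (hcd : ContDiff ℝ n Φ) (T : Finset L) : dirPower Φ n T = dirPower Φ n (T ∩ S) := by
  unfold dirPower
  rw [iteratedFDeriv_apply_eq_projOn hΦ hcd]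
  simp only [projOn_sum_single]

omit [LinearOrder L] in
/-- **the low-order terms over the scales `T` are those over `T ∩ S`** (`Φ ∈ C^{n̄}` depending only on `S`): print's reduction
of the sums `Σ_{j_α=0}^{k}`, `Σ_{l=0}^{k}` to `j_α, l ≥ j`. [cite: BalabanImbrieJaffe1988, (5.7.10) p.292] -/
theorem lowOrder_eq_lowOrder_inter {Φ : (L → ℝ) → ℝ} {S : Finset L} (hΦ : DependsOnlyOn Φ S) {nbar : ℕ}
    (hcd : ContDiff ℝ nbar Φ) (T : Finset L) : lowOrder Φ nbar T = lowOrder Φ nbar (T ∩ S) := by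
  unfold lowOrder
  refine Finset.sum_congr rfl fun n hn => ?_
  have hle : (n : WithTop ℕ∞) ≤ nbar := by exact_mod_cast (Finset.mem_Icc.mp hn).2
  rw [dirPower_eq_dirPower_inter hΦ (hcd.of_le hle)]

/-- **THE PRINTED PASSAGE END TO END** — *"Note that Z^{(j)}_{Λ₁₀^{(j)}}(…) depends only on e_l for l ≥ j. Thus we can write the
last expression as Σ_{m=j}^{k} Σ_{n=1}^{n̄} (1/n!) Σ_{{j_α}: min_α j_α = m} […] (5.7.10)"*: for `Φ ∈ C^{n̄}` depending only on the
scales of `S`, the low-order terms over ANY scale set `T` (print: `{0,…,k}`) equal the sum over `m ∈ T ∩ S` (print: `m = j,…,k`)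
of the `m`-th groups of (5.7.10) formed inside `T ∩ S` — p13's `eq5710` after the reduction `lowOrder_eq_lowOrder_inter`.
[cite: BalabanImbrieJaffe1988, (5.7.10) p.292] -/
theorem eq5710_of_dependsOnlyOn {Φ : (L → ℝ) → ℝ} {S : Finset L} (hΦ : DependsOnlyOn Φ S) {nbar : ℕ}
    (hcd : ContDiff ℝ nbar Φ) (T : Finset L) :
    lowOrder Φ nbar T = ∑ m ∈ T ∩ S, leadGroup Φ nbar (T ∩ S) m := by
  rw [lowOrder_eq_lowOrder_inter hΦ hcd T, eq5710]

/-- the same with the groups indexed by ALL of `T`: the scales of `T` outside `S` head EMPTY groups (`leadGroup … m = 0` for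
`m ∉ T ∩ S`), so the sum may run over `m ∈ T` as well. [cite: BalabanImbrieJaffe1988, (5.7.10) p.292] -/
theorem eq5710_of_dependsOnlyOn' {Φ : (L → ℝ) → ℝ} {S : Finset L} (hΦ : DependsOnlyOn Φ S) {nbar : ℕ}
    (hcd : ContDiff ℝ nbar Φ) (T : Finset L) :
    lowOrder Φ nbar T = ∑ m ∈ T, leadGroup Φ nbar (T ∩ S) m := by
  rw [eq5710_of_dependsOnlyOn hΦ hcd T]
  refine (Finset.sum_subset Finset.inter_subset_left fun m hmT hm => ?_)
  exact leadGroup_eq_zero_of_not_mem Φ nbar hm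

end Literature.MathematicalPhysics.QuantumFieldTheory.BalabanImbrieJaffe1984to88.BIJ88Resummation5710Restrict

end
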